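import Literature.Probability.RandomPlanarGeometry.SLESixMoebiusLocalization
import Literature.Probability.RandomPlanarGeometry.SLETwoPointItoProofs
import HarnessLib

/-!
# The localised pole data of the Möbius image of SLE₆: stopping times, bounds, regularity

Topic `Probability/RandomPlanarGeometry`; theorems only, about the processes of
`SLESixMoebiusLocalization.lean` (Lawler (2005), §4.6.1 / §6.3 for the Möbius map
`Φ_x = a + b/(p - ·)`, `a = x`, `b = x²`, `p = -x`, driving function `√6 B`):

* `isStoppingTime_gapExit`, `isStoppingTime_locTime` — the localising time `ρ = locTime x n` is a
  stopping time of the raw Brownian filtration, bounded by `N = n + 1`;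
* `X_mem_band`, `abs_X_mem_Icc`, `X_ne_zero`, `ratio_mem_Icc` — up to (and, by stopping, after)
  `ρ` the gap satisfies `1/N ≤ |X| ≤ N` and the ratio `1/N ≤ b d₁/|X| ≤ N` (for `1/N < |x| < N`);
* continuity, adaptedness and progressive measurability of the localised gap `X`;
* `exp_neg_timeIntegral_trunc_eq` — pathwise calculus: for a continuous `G` and a random time
  `ρ`, `exp(-∫₀ᵗ 𝟙_{s≤ρ} G) = 1 + ∫₀ᵗ 𝟙_{s≤ρ} (-G_s) exp(-∫₀ˢ 𝟙 G)` (fundamental theorem of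
  calculus up to `ρ`, both sides frozen after) — the finite-variation structure of the jet
  `d₁ = exp(-∫ 2/X²)` used in `SLESixMoebiusPoleData.lean`.

## References

* G. F. Lawler, *Conformally Invariant Processes in the Plane*, AMS (2005), §4.6.1, §6.3.
  [Lawler2005]
-/

noncomputable section

open MeasureTheory Filter Set
open scoped NNReal ENNReal Topology

namespace Literature.Probability.RandomPlanarGeometry

namespace SLESixMoebius

open Literature.Probability.Process Literature.Analysis.FunctionSpaces

/-! ### Pathwise calculus: the exponential of a killed time integral -/

section Calculus

variable {Ω : Type*} {G : ℝ≥0 → Ω → ℝ} {ρ : Ω → WithTop ℝ≥0} {ω : Ω}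

/-- After a finite truncation time the killed time integral is frozen. [folklore] -/
theorem timeIntegral_trunc_eq_of_lt {t r₀ : ℝ≥0} (hr₀ : ρ ω = r₀) (hr₀t : r₀ ≤ t)
    (H : ℝ≥0 → Ω → ℝ) : timeIntegral (trunc ρ H) t ω = timeIntegral (trunc ρ H) r₀ ω := by
  rw [timeIntegral_trunc, timeIntegral_trunc, hr₀, min_self, min_eq_right (WithTop.coe_le_coe.2 hr₀t)]

/-- **The exponential of a killed time integral is a time integral** (pathwise calculus). Let
`s ↦ G_s(ω)` be continuous and `ρ` a random time. Then for all `t`,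
`exp(-∫₀ᵗ 𝟙_{s≤ρ} G_s ds) = 1 + ∫₀ᵗ 𝟙_{s≤ρ} (-G_s exp(-∫₀ˢ 𝟙_{r≤ρ} G_r dr)) ds`: the fundamental
theorem of calculus for `exp(-∫G)` on `[0, t ∧ ρ]`, and constancy of both sides after `ρ`. This is
the finite-variation structure of the jet `g_t'(p) = exp(-∫₀ᵗ 2/(g_s(p) - W_s)² ds)` (Lawler's
(4.7)). [folklore] -/
theorem exp_neg_timeIntegral_trunc_eq (hG : Continuous fun s ↦ G s ω) (t : ℝ≥0) :
    Real.exp (-timeIntegral (trunc ρ G) t ω) = 1 +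
      timeIntegral (trunc ρ fun s ω ↦ -G s ω * Real.exp (-timeIntegral (trunc ρ G) s ω)) t ω := by
  -- the continuous path and its primitive
  set g : ℝ → ℝ := fun s ↦ G s.toNNReal ω with hgdef
  have hg : Continuous g := hG.comp continuous_real_toNNReal
  set F₀ : ℝ → ℝ := fun s ↦ ∫ r in (0 : ℝ)..s, g r with hF₀def
  have hF₀d : ∀ s, HasDerivAt F₀ (g s) s := fun s ↦ (hg.integral_hasStrictDerivAt 0 s).hasDerivAt
  have hF₀c : Continuous F₀ := continuous_iff_continuousAt.2 fun s ↦ (hF₀d s).continuousAt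
  -- Step 1: the identity up to a time `T` with `↑T ≤ ρ ω`
  have step : ∀ T : ℝ≥0, (T : WithTop ℝ≥0) ≤ ρ ω →
      Real.exp (-timeIntegral (trunc ρ G) T ω) = 1 +
        timeIntegral (trunc ρ fun s ω ↦ -G s ω * Real.exp (-timeIntegral (trunc ρ G) s ω)) T ω := by
    intro T hT
    have hFT : ∀ s ∈ Icc (0 : ℝ) T, timeIntegral (trunc ρ G) s.toNNReal ω = F₀ s := by
      intro s hs
      simp only [timeIntegral, hF₀def, Real.coe_toNNReal _ hs.1]
      refine intervalIntegral.integral_congr fun r hr ↦ ?_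
      rw [uIcc_of_le hs.1] at hr
      exact trunc_toNNReal_eq_of_le hT ⟨hr.1, hr.2.trans hs.2⟩
    -- FTC for `exp(-F₀)` on `[0, T]`
    have hderiv : ∀ s ∈ Ioo (0 : ℝ) T,
        HasDerivAt (fun s ↦ Real.exp (-F₀ s)) (-(g s) * Real.exp (-F₀ s)) s := by
      intro s _
      have h : HasDerivAt (fun s ↦ Real.exp (-F₀ s)) (Real.exp (-F₀ s) * -g s) s :=
        (hF₀d s).neg.exp
      refine h.congr_deriv ?_
      ring
    have hcont : ContinuousOn (fun s ↦ Real.exp (-F₀ s)) (Icc 0 T) :=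
      (Real.continuous_exp.comp hF₀c.neg).continuousOn
    have hcont' : ContinuousOn (fun s ↦ -(g s) * Real.exp (-F₀ s)) (Icc 0 T) :=
      (hg.neg.mul (Real.continuous_exp.comp hF₀c.neg)).continuousOn
    have hFTC := intervalIntegral.integral_eq_sub_of_hasDerivAt_of_le T.coe_nonneg hcont hderiv
      (hcont'.intervalIntegrable_of_Icc T.coe_nonneg)
    have hL : timeIntegral (trunc ρ G) T ω = F₀ T := by
      have := hFT T ⟨T.coe_nonneg, le_rfl⟩
      rwa [Real.toNNReal_coe] at this
    have hR : timeIntegral (trunc ρ fun s ω ↦ -G s ω * Real.exp (-timeIntegral (trunc ρ G) s ω)) T ω =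
        ∫ s in (0 : ℝ)..T, -(g s) * Real.exp (-F₀ s) := by
      simp only [timeIntegral]
      refine intervalIntegral.integral_congr fun s hs ↦ ?_
      rw [uIcc_of_le T.coe_nonneg] at hs
      have h1 := hFT s hs
      simp only [timeIntegral] at h1
      rw [trunc_toNNReal_eq_of_le hT hs, h1]
    have h0 : F₀ 0 = 0 := by simp [hF₀def]
    rw [hL, hR, hFTC, h0, neg_zero, Real.exp_zero]
    ring
  -- Step 2: the general case
  by_cases ht : (t : WithTop ℝ≥0) ≤ ρ ω
  · exact step t ht
  · rw [not_le] at ht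
    obtain ⟨r₀, hr₀⟩ := WithTop.ne_top_iff_exists.1 ht.ne_top
    have hr₀t : r₀ < t := by rw [← hr₀] at ht; exact WithTop.coe_lt_coe.1 ht
    have hstep := step r₀ (by rw [hr₀])
    rw [timeIntegral_trunc_eq_of_lt hr₀.symm hr₀t.le, timeIntegral_trunc_eq_of_lt hr₀.symm hr₀t.le]
    exact hstep

end Calculus

variable {x : ℝ} {n : ℕ}

/-! ### Levels -/

/-- `1 ≤ N`. [folklore] -/
theorem one_le_level (n : ℕ) : 1 ≤ level n := by
  unfold level; linarith [n.cast_nonneg (α := ℝ)]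

/-- `1/N ≤ N`. [folklore] -/
theorem inv_level_le_level (n : ℕ) : 1 / level n ≤ level n := by
  have h1 := one_le_level n
  rw [div_le_iff₀ (show 0 < level n by unfold level; positivity)]
  nlinarith

/-- The cap `N` as a nonnegative real coerces to `level n`. [folklore] -/
theorem coe_cap (n : ℕ) : (((n : ℝ≥0) + 1 : ℝ≥0) : ℝ) = level n := by
  unfold level; push_cast; ring

/-- The band lies inside `{y | 1/N ≤ |y| ≤ N}`. [folklore] -/
theorem abs_mem_Icc_of_mem_band {y : ℝ} (hy : y ∈ Icc (bandLo x n) (bandHi x n)) :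
    |y| ∈ Icc (1 / level n) (level n) := by
  unfold bandLo bandHi at hy
  have hN := (show 0 < level n by unfold level; positivity)
  have hN' : 0 < 1 / level n := by positivity
  split_ifs at hy with h
  · have hyneg : y < 0 := by linarith [hy.2]
    rw [abs_of_neg hyneg]
    exact ⟨by linarith [hy.2], by linarith [hy.1]⟩
  · have hypos : 0 < y := by linarith [hy.1]
    rw [abs_of_pos hypos]
    exact hy

/-- A point of the band is nonzero. [folklore] -/
theorem ne_zero_of_mem_band {y : ℝ} (hy : y ∈ Icc (bandLo x n) (bandHi x n)) :
    y ≠ 0 := by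
  have h := (abs_mem_Icc_of_mem_band hy).1
  have hN' : 0 < 1 / level n := by have := (show 0 < level n by unfold level; positivity); positivity
  intro h0
  rw [h0, abs_zero] at h
  linarith

/-- The pole `-x` lies strictly inside the band when `1/N < |x| < N`. [folklore] -/
theorem neg_mem_Ioo_band (hx1 : 1 / level n < |x|) (hx2 : |x| < level n) :
    -x ∈ Ioo (bandLo x n) (bandHi x n) := by
  unfold bandLo bandHi
  split_ifs with h
  · rw [abs_of_pos h] at hx1 hx2
    exact ⟨by linarith, by linarith⟩
  · have hx0 : x ≠ 0 := by
      intro h0; rw [h0, abs_zero] at hx1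
      have := (show 0 < level n by unfold level; positivity); have : 0 < 1 / level n := by positivity
      linarith
    have hneg : x < 0 := lt_of_le_of_ne (not_lt.1 h) hx0
    rw [abs_of_neg hneg] at hx1 hx2
    exact ⟨by linarith, by linarith⟩

/-! ### The gap: continuity, adaptedness -/

/-- `x ≠ 0` from the level hypothesis. [folklore] -/
theorem ne_zero_of_inv_level_lt (hx1 : 1 / level n < |x|) : x ≠ 0 := by
  intro h0; rw [h0, abs_zero] at hx1
  have := (show 0 < level n by unfold level; positivity); have : 0 < 1 / level n := by positivity
  linarith

/-- The gap has continuous paths. [folklore] -/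
theorem continuous_gap (hx : x ≠ 0) (ω : ℝ≥0 → ℝ) : Continuous fun t ↦ gap x t ω :=
  continuous_sleRealFlowStop (neg_ne_zero.2 hx) ω

/-- The gap starts at the pole `-x`. [folklore] -/
theorem gap_zero (hx : x ≠ 0) (ω : ℝ≥0 → ℝ) : gap x 0 ω = -x :=
  sleRealFlowStop_zero_apply (neg_ne_zero.2 hx) ω

/-- The gap is adapted to the raw Brownian filtration. [folklore] -/
theorem adapted_gap (hx : x ≠ 0) : Adapted brownianFiltration (gap x) :=
  adapted_sleRealFlowStop 6 (neg_ne_zero.2 hx)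

/-- The gap is progressively measurable. [folklore] -/
theorem isStronglyProgressive_gap (hx : x ≠ 0) : IsStronglyProgressive brownianFiltration (gap x) :=
  isStronglyProgressive_sleRealFlowStop 6 (neg_ne_zero.2 hx)

/-! ### The stopping times -/

/-- The band exit of the gap is a stopping time. [folklore] -/
theorem isStoppingTime_gapExit (hx : x ≠ 0) : IsStoppingTime brownianFiltration (gapExit x n) :=
  Process.isStoppingTime_exitTime (adapted_gap hx) (continuous_gap hx)

/-- The gap stopped at its band exit stays in the band (`1/N < |x| < N`). [folklore] -/
theorem stoppedProcess_gap_gapExit_mem (hx1 : 1 / level n < |x|) (hx2 : |x| < level n)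
    (t : ℝ≥0) (ω : ℝ≥0 → ℝ) :
    stoppedProcess (gap x) (gapExit x n) t ω ∈ Icc (bandLo x n) (bandHi x n) := by
  have hx := ne_zero_of_inv_level_lt hx1
  have h0 : gap x 0 ω ∈ Ioo (bandLo x n) (bandHi x n) := by
    rw [gap_zero hx]; exact neg_mem_Ioo_band hx1 hx2
  exact Process.stoppedProcess_exitTime_mem_Icc (continuous_gap hx ω) h0 t

/-- The gap stopped at its band exit never vanishes. [folklore] -/
theorem stoppedProcess_gap_gapExit_ne_zero (hx1 : 1 / level n < |x|) (hx2 : |x| < level n)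
    (t : ℝ≥0) (ω : ℝ≥0 → ℝ) : stoppedProcess (gap x) (gapExit x n) t ω ≠ 0 :=
  ne_zero_of_mem_band (stoppedProcess_gap_gapExit_mem hx1 hx2 t ω)

/-- The pre-localised jet `poleDerivPre` has continuous paths. [folklore] -/
theorem continuous_poleDerivPre (hx1 : 1 / level n < |x|) (hx2 : |x| < level n) (ω : ℝ≥0 → ℝ) :
    Continuous fun t ↦ poleDerivPre x n t ω := by
  have hx := ne_zero_of_inv_level_lt hx1
  unfold poleDerivPre
  refine Real.continuous_exp.comp (continuous_timeIntegral fun t ↦ integrableOn_trunc ?_).neg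
  have hc : Continuous fun s : ℝ ↦ 2 / stoppedProcess (gap x) (gapExit x n) s.toNNReal ω ^ 2 :=
    continuous_const.div (((Process.continuous_stoppedProcess_path (continuous_gap hx ω) _).comp
      continuous_real_toNNReal).pow 2) fun s ↦ pow_ne_zero 2
        (stoppedProcess_gap_gapExit_ne_zero hx1 hx2 _ ω)
  exact hc.continuousOn.integrableOn_compact isCompact_Icc

/-- The pre-localised jet is adapted. [folklore] -/
theorem isStronglyProgressive_poleDerivPre (hx : x ≠ 0) :
    IsStronglyProgressive brownianFiltration (poleDerivPre x n) := by
  have hst := isStoppingTime_gapExit (n := n) hx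
  have hV : IsStronglyProgressive brownianFiltration (stoppedProcess (gap x) (gapExit x n)) :=
    (isStronglyProgressive_gap hx).stoppedProcess hst
  have hr : IsStronglyProgressive brownianFiltration (trunc (gapExit x n)
      fun s ω ↦ 2 / stoppedProcess (gap x) (gapExit x n) s ω ^ 2) :=
    isStronglyProgressive_trunc (IsStronglyProgressive.comp_measurable₂ hV
      (F := fun _ v ↦ 2 / v ^ 2) (measurable_const.div (measurable_snd.pow_const 2)))
      fun t ↦ hst.measurableSet_lt t
  unfold poleDerivPre
  exact IsStronglyProgressive.continuous_comp
    (IsStronglyProgressive.continuous_comp (isStronglyProgressive_timeIntegral hr) continuous_neg)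
    Real.continuous_exp

/-- The pre-localised ratio has continuous paths. [folklore] -/
theorem continuous_ratioPre (hx1 : 1 / level n < |x|) (hx2 : |x| < level n) (ω : ℝ≥0 → ℝ) :
    Continuous fun t ↦ ratioPre x n t ω := by
  have hx := ne_zero_of_inv_level_lt hx1
  unfold ratioPre
  exact (continuous_const.mul (continuous_poleDerivPre hx1 hx2 ω)).div
    (continuous_abs.comp (Process.continuous_stoppedProcess_path (continuous_gap hx ω) _))
    fun t ↦ abs_ne_zero.2 (stoppedProcess_gap_gapExit_ne_zero hx1 hx2 t ω)

/-- The pre-localised ratio is progressively measurable. [folklore] -/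
theorem isStronglyProgressive_ratioPre (hx : x ≠ 0) :
    IsStronglyProgressive brownianFiltration (ratioPre x n) := by
  have hst := isStoppingTime_gapExit (n := n) hx
  have hV : IsStronglyProgressive brownianFiltration (stoppedProcess (gap x) (gapExit x n)) :=
    (isStronglyProgressive_gap hx).stoppedProcess hst
  have hφ : Measurable (Function.uncurry fun d v : ℝ ↦ x ^ 2 * d / |v|) :=
    (measurable_fst.const_mul _).div measurable_snd.abs
  exact isStronglyProgressive_comp₂ (isStronglyProgressive_poleDerivPre (n := n) hx) hV hφ

/-- The pre-localised ratio is adapted. [folklore] -/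
theorem adapted_ratioPre (hx : x ≠ 0) : Adapted brownianFiltration (ratioPre x n) := fun t ↦
  ((isStronglyProgressive_ratioPre (n := n) hx).stronglyAdapted t).measurable

/-- The pre-localised ratio starts at `|x|`. [folklore] -/
theorem ratioPre_zero (hx : x ≠ 0) (ω : ℝ≥0 → ℝ) : ratioPre x n 0 ω = |x| := by
  unfold ratioPre poleDerivPre
  rw [timeIntegral_apply_zero, neg_zero, Real.exp_zero, mul_one,
    stoppedProcess_eq_of_le (by simp), gap_zero hx, abs_neg]
  have h : |x| ≠ 0 := abs_ne_zero.2 hx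
  field_simp
  rw [sq_abs, sq]

/-- **The localising time is a stopping time** of the raw Brownian filtration. [folklore] -/
theorem isStoppingTime_locTime (hx1 : 1 / level n < |x|) (hx2 : |x| < level n) :
    IsStoppingTime brownianFiltration (locTime x n) := by
  have hx := ne_zero_of_inv_level_lt hx1
  have h1 := isStoppingTime_gapExit (n := n) hx
  have h2 : IsStoppingTime brownianFiltration
      (Process.exitTime (ratioPre x n) (1 / level n) (level n)) :=
    Process.isStoppingTime_exitTime (adapted_ratioPre hx) (continuous_ratioPre hx1 hx2)
  exact h1.min (h2.min_const _)

/-- The localising time is at most the band exit. [folklore] -/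
theorem locTime_le_gapExit (ω : ℝ≥0 → ℝ) : locTime x n ω ≤ gapExit x n ω := min_le_left _ _

/-- The localising time is at most the ratio exit. [folklore] -/
theorem locTime_le_ratioExit (ω : ℝ≥0 → ℝ) :
    locTime x n ω ≤ Process.exitTime (ratioPre x n) (1 / level n) (level n) ω :=
  (min_le_right _ _).trans (min_le_left _ _)

/-- The localising time is at most the cap `N`. [folklore] -/
theorem locTime_le_cap (ω : ℝ≥0 → ℝ) :
    locTime x n ω ≤ (((n : ℝ≥0) + 1 : ℝ≥0) : WithTop ℝ≥0) :=
  (min_le_right _ _).trans (min_le_right _ _)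

/-- The localising time is finite. [folklore] -/
theorem locTime_ne_top (ω : ℝ≥0 → ℝ) : locTime x n ω ≠ ⊤ :=
  ne_top_of_le_ne_top WithTop.coe_ne_top (locTime_le_cap ω)

/-- The stopped clock `t ∧ ρ` is at most `ρ`. [folklore] -/
theorem coe_untopA_min_locTime_le (t : ℝ≥0) (ω : ℝ≥0 → ℝ) :
    ((min (t : WithTop ℝ≥0) (locTime x n ω)).untopA : WithTop ℝ≥0) ≤ locTime x n ω :=
  Literature.Analysis.FunctionSpaces.coe_untopA_min_le t _

/-- The stopped clock `t ∧ ρ` is at most the cap `N`. [folklore] -/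
theorem untopA_min_locTime_le_cap (t : ℝ≥0) (ω : ℝ≥0 → ℝ) :
    (min (t : WithTop ℝ≥0) (locTime x n ω)).untopA ≤ (n : ℝ≥0) + 1 :=
  WithTop.coe_le_coe.1 ((coe_untopA_min_locTime_le t ω).trans (locTime_le_cap ω))

/-! ### The localised gap -/

/-- Before `ρ` the localised gap is the gap. [folklore] -/
theorem X_eq_gap_of_le {t : ℝ≥0} {ω : ℝ≥0 → ℝ} (h : (t : WithTop ℝ≥0) ≤ locTime x n ω) :
    X x n t ω = gap x t ω :=
  stoppedProcess_eq_of_le h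

/-- The localised gap is the gap stopped at the band exit, read at the stopped clock. [folklore] -/
theorem X_eq_stoppedProcess_gapExit (t : ℝ≥0) (ω : ℝ≥0 → ℝ) :
    X x n t ω = stoppedProcess (gap x) (gapExit x n) ((min (t : WithTop ℝ≥0) (locTime x n ω)).untopA) ω := by
  unfold X
  rw [stoppedProcess, stoppedProcess_eq_of_le ((coe_untopA_min_locTime_le t ω).trans (locTime_le_gapExit ω))]

/-- **The localised gap stays in the band.** [folklore] -/
theorem X_mem_band (hx1 : 1 / level n < |x|) (hx2 : |x| < level n) (t : ℝ≥0) (ω : ℝ≥0 → ℝ) :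
    X x n t ω ∈ Icc (bandLo x n) (bandHi x n) := by
  rw [X_eq_stoppedProcess_gapExit]
  exact stoppedProcess_gap_gapExit_mem hx1 hx2 _ ω

/-- `1/N ≤ |X| ≤ N`. [folklore] -/
theorem abs_X_mem_Icc (hx1 : 1 / level n < |x|) (hx2 : |x| < level n) (t : ℝ≥0) (ω : ℝ≥0 → ℝ) :
    |X x n t ω| ∈ Icc (1 / level n) (level n) :=
  abs_mem_Icc_of_mem_band (X_mem_band hx1 hx2 t ω)

/-- The localised gap never vanishes. [folklore] -/
theorem X_ne_zero (hx1 : 1 / level n < |x|) (hx2 : |x| < level n) (t : ℝ≥0) (ω : ℝ≥0 → ℝ) :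
    X x n t ω ≠ 0 :=
  ne_zero_of_mem_band (X_mem_band hx1 hx2 t ω)

/-- The gap does not vanish on `[0, ρ]` (the hypothesis of `isItoProcess_stoppedProcess_sleRealFlowStop`).
[folklore] -/
theorem gap_ne_zero_of_le (hx1 : 1 / level n < |x|) (hx2 : |x| < level n) (ω : ℝ≥0 → ℝ) (t : ℝ≥0)
    (h : (t : WithTop ℝ≥0) ≤ locTime x n ω) : gap x t ω ≠ 0 := by
  rw [← X_eq_gap_of_le h]; exact X_ne_zero hx1 hx2 t ω

/-- The localised gap starts at `-x`. [folklore] -/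
theorem X_zero (hx : x ≠ 0) (ω : ℝ≥0 → ℝ) : X x n 0 ω = -x := by
  rw [X_eq_gap_of_le (by simp), gap_zero hx]

/-- The localised gap has continuous paths. [folklore] -/
theorem continuous_X (hx : x ≠ 0) (ω : ℝ≥0 → ℝ) : Continuous fun t ↦ X x n t ω :=
  Process.continuous_stoppedProcess_path (continuous_gap hx ω) _

/-- The localised gap is strongly adapted. [folklore] -/
theorem stronglyAdapted_X (hx1 : 1 / level n < |x|) (hx2 : |x| < level n) :
    StronglyAdapted brownianFiltration (X x n) :=
  (isStronglyProgressive_gap (ne_zero_of_inv_level_lt hx1)).stronglyAdapted_stoppedProcess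
    (isStoppingTime_locTime hx1 hx2)

/-- The localised gap is progressively measurable. [folklore] -/
theorem isStronglyProgressive_X (hx1 : 1 / level n < |x|) (hx2 : |x| < level n) :
    IsStronglyProgressive brownianFiltration (X x n) :=
  (stronglyAdapted_X hx1 hx2).isStronglyProgressive_of_continuous
    (continuous_X (ne_zero_of_inv_level_lt hx1))

end SLESixMoebius

end Literature.Probability.RandomPlanarGeometry

end
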